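import Literature.IUT.HodgeArakelov.ThetaEvaluationModelEvDiagramIsmOrbit
import Literature.IUT.HodgeArakelov.AbsTopMonoidsGenuineOfSettingPadicClosure
import HarnessLib

/-!
# [IUTchII] Cor 1.12 (iii) at the model with FULLY GENUINE [AbsTopIII]-output data — over THE SETTING'S OWN FIELD `K`
# (the `(k, ε)` binder of abc-iut-w4-d043's `cor112_iii_model_genuine{Ism,ZHat}_of_tower` INSTANTIATED)

S. Mochizuki, *Inter-universal Teichmüller theory II*, §1, Cor. 1.12 (iii) (kurims p. 58) [claim: Mochizuki2012, status: disputed].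
abc-iut-w4-d043's `ThetaEvaluationModelEvDiagramIsmOrbit.lean` proves Cor. 1.12 (iii) at the [EtTh]-model setting
`EtaleLevels.setting` with the genuine `AbsTopMonoids` producers `genuineOfModelIsm` over `(k, ℚ̄_p)` for an ARBITRARY
non-archimedean local field `k ⊆ ℚ̄_p` with `[IsAlgClosure k ℚ̄_p]` and an identification `ε` of the setting's `G_K` with
`Gal(ℚ̄_p/k)` — listing «the producer's `ε`» among the residual named inputs.  THIS PROOF-ONLY FILE (two theorems, no
definitions) takes `k := K`, the setting's own base field `K ⊆ ℚ̄_p` with its extended absolute value (abc-iut L4/S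
`FiniteExtension.*`; `IsAlgClosure K ℚ̄_p` by abc-iut-L3's `isAlgClosure_of_intermediateField`), for which the anonymous datum
`{k := K, K := ℚ̄_p}` IS abc-iut-w5-d233's `TemperedCurve.mlfClosurePadic` (p431000) definitionally, and
`ε := TemperedCurve.galoisEpsilonPadic` (`σ ↦ σ`, choice-free).  Residual named inputs afterwards: `hcU`, the finite-index /
`hDq` / `hlift` / `hemb` clauses, (H1) `hΔ`, (H2) `hq` — no model identification.

HONEST SCOPE: a specialisation, nothing else; no curve / theta setting asserted to exist; nothing here bears on [IUTchIII]
Cor. 3.12; no side is taken; typed ≠ proved elsewhere.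
-/

noncomputable section

namespace Literature.IUT.HodgeArakelov

open CategoryTheory Literature.AnabelianGeometry.AbsoluteAnabelian
open Literature.AnabelianGeometry.EtaleTheta Literature.AnabelianGeometry.SemiGraphs CohomologySystemOfContH1
open Literature.NumberTheory.GaloisRepresentations
open scoped Literature.AnabelianGeometry.EtaleTheta

namespace EtaleLevels


variable {p : ℕ} [Fact p.Prime] {D : Literature.AnabelianGeometry.EtaleTheta.ThetaSetting p}
  {E : D.EtaleThetaData} {l : ℕ} (C : E.DoubleUnderline l) (hC : D.Compat) (hS : D.Sec2Hyps)
  (hl : l.Prime) (hp2 : p ≠ 2) (hpl : p ≠ l) (hζ : ∃ ζ : D.K, IsPrimitiveRoot ζ (4 * l))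
  (mods : ∀ M : ℕ+, D.CyclotomeMod l M)
  (f : contCocycles D.toTheta D.DeltaTheta C.GtpYdduu) (hf : f ∈ C.rootCocycles hC)
  (hmods : ∀ (M M' : ℕ+) (h : (M : ℕ) ∣ (M' : ℕ)) (x : D.lDeltaTheta l),
    MuN.red p M M' h ((mods M').red x) = (mods M).red x)
  (h15 : Literature.AnabelianGeometry.EtaleTheta.ThetaSetting.Prop15iii E hC) (L : C.CuspLabels)
  (hZ : ∀ M : ℕ+, Nonempty (ModelCyclotomes.lDeltaQuot (C.rigidData (mods M) hC hS h15 L) ≃*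
    Literature.IUT.HodgeTheaters.ZHat))
  (hcharY : EtaleThetaDataOfSetting.PiYddCharacteristic C)
  (hlim : Function.Bijective (rigidLimHom C hC hS hl hp2 hpl hζ mods f hf hmods h15 L hZ))
  (Env : EnvOfGroup (setting C hC hS hl hp2 hpl hζ mods f hf)
    (modelSystem C hC hS hl hp2 hpl hζ mods f hf hmods h15 L hZ).PiX)
  (I : PointedInversion Env (thetaEnvData C hC hS hl hp2 hpl hζ mods f hf hmods h15 L hZ hcharY hlim).D)
  (hDq : ∀ d ∈ I.Dmu, EtaleThetaDataOfSetting.aug C d = 1 → d = 1)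
  (hlift : ∀ K : Subgroup (EtaleThetaDataOfSetting.Pi C), K.FiniteIndex → IsOpen (K : Set (EtaleThetaDataOfSetting.Pi C)) →
    (liftSubgroup (EtaleThetaDataOfSetting.aug C) I.Dmu K).FiniteIndex ∧
      IsOpen (liftSubgroup (EtaleThetaDataOfSetting.aug C) I.Dmu K : Set (EtaleThetaDataOfSetting.Pi C)))
  (hemb : ∀ K : Subgroup (EtaleThetaDataOfSetting.Pi C),
    Topology.IsEmbedding fun d : ↥(I.Dmu ⊓ K) => EtaleThetaDataOfSetting.aug C d.1)
  (cU : CyclotomeCoefficients (EtaleThetaDataOfSetting.phi C) (D.lDeltaTheta l) (PadicAlgCl p)ˣ)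
  (ρlim : (EtaleThetaDataOfSetting.coh C).lim ≃+ (EtaleThetaDataOfSetting.coh C).lim)

variable
  (hΔ : ∀ φ : (setting C hC hS hl hp2 hpl hζ mods f hf).PiX ≃ₜ* (setting C hC hS hl hp2 hpl hζ mods f hf).PiX,
    (setting C hC hS hl hp2 hpl hζ mods f hf).DeltaX.map φ.toMulEquiv.toMonoidHom =
      (setting C hC hS hl hp2 hpl hζ mods f hf).DeltaX)
  (hq : Nonempty (TopGroup.quot (setting C hC hS hl hp2 hpl hζ mods f hf).PiX (setting C hC hS hl hp2 hpl hζ mods f hf).DeltaX ≃ₜ*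
    (setting C hC hS hl hp2 hpl hζ mods f hf).Gk))


/-- **[IUTchII] Cor 1.12 (iii) at the model with the FULLY GENUINE [AbsTopIII]-output data and `Γ^{×μ} = Ism(G)`,
over THE SETTING'S OWN FIELD `K`** — abc-iut-w4-d043's `cor112_iii_model_genuineIsm_of_tower` at `k := K ⊆ ℚ̄_p` (extended
absolute value; `{k := K, K := ℚ̄_p}` IS abc-iut-w5-d233's `TemperedCurve.mlfClosurePadic` definitionally) and
`ε := TemperedCurve.galoisEpsilonPadic` (`σ ↦ σ`): the producer's `(k, ε)` binder is GONE; residual named inputs = `hcU`,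
`[G_{ℚ_p} : ε(D_{μ_-})] < ∞` + `hDq`/`hlift`/`hemb`, (H1) `hΔ`, (H2) `hq`.
[claim: Mochizuki2012, status: disputed] (IUTchII §1 Cor 1.12 (iii), kurims p.58) -/
theorem cor112_iii_model_genuineIsm_of_tower_ownField [(Subgroup.map (EtaleThetaDataOfSetting.aug C) I.Dmu).FiniteIndex] (hcU : Function.Bijective cU.hom)
    (G : IsoClass (setting C hC hS hl hp2 hpl hζ mods f hf).Gk) :
    ∃ Δ : MuXmuDiagram
        (thetaEvaluation C hC hS hl hp2 hpl hζ mods f hf hmods h15 L hZ hcharY hlim Env I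
            (LevelRetraction.ofAugmentation (EtaleThetaDataOfSetting.phi C) (D.lDeltaTheta l)
              (EtaleThetaDataOfSetting.aug C) I.Dmu hDq (EtaleThetaDataOfSetting.PiYdd C)
              (EtaleThetaDataOfSetting.continuous_aug C) (aug_ker_acts_trivially C) hlift hemb)
            cU (EtaleThetaDataOfSetting.isOpen_stabilizer_units C) (EtaleThetaDataOfSetting.finiteIndex_stabilizer_units C)
            (unitGroup ℚ_[p] (PadicAlgCl p)) ρlim)
        (AbsTopMonoids.genuineOfModelIsm (setting C hC hS hl hp2 hpl hζ mods f hf) D.toTemperedCurve.mlfClosurePadic D.toTemperedCurve.galoisEpsilonPadic hΔ hq) G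
        ↥(AddCommGroup.torsion (thetaEnvData C hC hS hl hp2 hpl hζ mods f hf hmods h15 L hZ hcharY hlim).cohEnv.lim)
        (AddCommGroup.torsion (thetaEnvData C hC hS hl hp2 hpl hζ mods f hf hmods h15 L hZ hcharY hlim).cohEnv.lim).subtype,
      Δ.poly₄₅ = {e | ∃ (φ : AbsTopMonoids.Genuine.qObj hq (IsoClass.base (setting C hC hS hl hp2 hpl hζ mods f hf).PiX) ⟶ G)
          (γ : (AbsTopMonoids.genuineOfModelIsm (setting C hC hS hl hp2 hpl hζ mods f hf) D.toTemperedCurve.mlfClosurePadic D.toTemperedCurve.galoisEpsilonPadic hΔ hq).Ism G),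
        ∀ (u : ↥(unitGroup ℚ_[p] (PadicAlgCl p)))
          (m : ↥(thetaEvaluation C hC hS hl hp2 hpl hζ mods f hf hmods h15 L hZ hcharY hlim Env I
            (LevelRetraction.ofAugmentation (EtaleThetaDataOfSetting.phi C) (D.lDeltaTheta l)
              (EtaleThetaDataOfSetting.aug C) I.Dmu hDq (EtaleThetaDataOfSetting.PiYdd C)
              (EtaleThetaDataOfSetting.continuous_aug C) (aug_ker_acts_trivially C) hlift hemb)
            cU (EtaleThetaDataOfSetting.isOpen_stabilizer_units C) (EtaleThetaDataOfSetting.finiteIndex_stabilizer_units C)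
            (unitGroup ℚ_[p] (PadicAlgCl p)) ρlim).MxTM)
          (w : (nonzeroIntegers D.toTemperedCurve.mlfClosurePadic.k D.toTemperedCurve.mlfClosurePadic.K)ˣ),
          (m : (thetaEvaluation C hC hS hl hp2 hpl hζ mods f hf hmods h15 L hZ hcharY hlim Env I
            (LevelRetraction.ofAugmentation (EtaleThetaDataOfSetting.phi C) (D.lDeltaTheta l)
              (EtaleThetaDataOfSetting.aug C) I.Dmu hDq (EtaleThetaDataOfSetting.PiYdd C)
              (EtaleThetaDataOfSetting.continuous_aug C) (aug_ker_acts_trivially C) hlift hemb)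
            cU (EtaleThetaDataOfSetting.isOpen_stabilizer_units C) (EtaleThetaDataOfSetting.finiteIndex_stabilizer_units C)
            (unitGroup ℚ_[p] (PadicAlgCl p)) ρlim).Hd) =
              Multiplicative.toAdd (h1LimKummer (EtaleThetaDataOfSetting.phi C) (D.lDeltaTheta l) I.Dmu cU
                (EtaleThetaDataOfSetting.isOpen_stabilizer_units C) (EtaleThetaDataOfSetting.finiteIndex_stabilizer_units C) u) →
          ((w : nonzeroIntegers D.toTemperedCurve.mlfClosurePadic.k D.toTemperedCurve.mlfClosurePadic.K) :
              D.toTemperedCurve.mlfClosurePadic.K) = ((u : (PadicAlgCl p)ˣ) : PadicAlgCl p) →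
            e (Multiplicative.ofAdd (QuotientAddGroup.mk m)) =
              (AbsTopMonoids.genuineOfModelIsm (setting C hC hS hl hp2 hpl hζ mods f hf) D.toTemperedCurve.mlfClosurePadic D.toTemperedCurve.galoisEpsilonPadic hΔ hq).actIsm G γ
                (QuotientGroup.mk (Units.map (AbsTopMonoids.Genuine.liftM D.toTemperedCurve.mlfClosurePadic
                  (AbsTopMonoids.Genuine.phiOf D.toTemperedCurve.mlfClosurePadic D.toTemperedCurve.galoisEpsilonPadic φ)).toMonoidHom w))} := by
  letI : IsNonarchimedeanLocalField ℚ_[p] := Padic.isNonarchimedeanLocalField_holds p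
  haveI : FiniteDimensional ℚ_[p] D.K := D.finiteDimensional_K
  -- all local-field / closure instances of `K` passed EXPLICITLY (the extended absolute value of the trunk)
  exact @cor112_iii_model_genuineIsm_of_tower p _ D E l C hC hS hl hp2 hpl hζ mods f hf hmods h15 L hZ hcharY hlim Env I hDq hlift
    hemb cU ρlim (↥D.K) _ (FiniteExtension.valuativeRel ℚ_[p] D.K) (FiniteExtension.topologicalSpace ℚ_[p] D.K)
    (FiniteExtension.isNonarchimedeanLocalField ℚ_[p] D.K)
    (charZero_of_injective_algebraMap (algebraMap ℚ_[p] D.K).injective) _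
    (Literature.FieldTheory.Galois.isAlgClosure_of_intermediateField D.K)
    D.toTemperedCurve.galoisEpsilonPadic hΔ hq _ D.finiteDimensional_K _ _ hcU G

/-- **[IUTchII] Cor 1.12 (iii) at the model with genuine monoids and `Γ^{×μ} = Ẑ^×`, over THE SETTING'S OWN FIELD `K`**
— abc-iut-w4-d043's `cor112_iii_model_genuineZHat_of_tower` at `k := K`, `ε := galoisEpsilonPadic` (same substitution as
above). [claim: Mochizuki2012, status: disputed] (IUTchII §1 Cor 1.12 (iii), kurims p.58) -/
theorem cor112_iii_model_genuineZHat_of_tower_ownField [(Subgroup.map (EtaleThetaDataOfSetting.aug C) I.Dmu).FiniteIndex] (hcU : Function.Bijective cU.hom)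
    (G : IsoClass (setting C hC hS hl hp2 hpl hζ mods f hf).Gk) :
    ∃ Δ : MuXmuDiagram
        (thetaEvaluation C hC hS hl hp2 hpl hζ mods f hf hmods h15 L hZ hcharY hlim Env I
            (LevelRetraction.ofAugmentation (EtaleThetaDataOfSetting.phi C) (D.lDeltaTheta l)
              (EtaleThetaDataOfSetting.aug C) I.Dmu hDq (EtaleThetaDataOfSetting.PiYdd C)
              (EtaleThetaDataOfSetting.continuous_aug C) (aug_ker_acts_trivially C) hlift hemb)
            cU (EtaleThetaDataOfSetting.isOpen_stabilizer_units C) (EtaleThetaDataOfSetting.finiteIndex_stabilizer_units C)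
            (unitGroup ℚ_[p] (PadicAlgCl p)) ρlim)
        (AbsTopMonoids.genuineOfModelIsm (setting C hC hS hl hp2 hpl hζ mods f hf) D.toTemperedCurve.mlfClosurePadic D.toTemperedCurve.galoisEpsilonPadic hΔ hq) G
        ↥(AddCommGroup.torsion (thetaEnvData C hC hS hl hp2 hpl hζ mods f hf hmods h15 L hZ hcharY hlim).cohEnv.lim)
        (AddCommGroup.torsion (thetaEnvData C hC hS hl hp2 hpl hζ mods f hf hmods h15 L hZ hcharY hlim).cohEnv.lim).subtype,
      Δ.poly₄₅ = {e | ∃ (φ : AbsTopMonoids.Genuine.qObj hq (IsoClass.base (setting C hC hS hl hp2 hpl hζ mods f hf).PiX) ⟶ G)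
          (w' : ZHatUnits),
        ∀ (u : ↥(unitGroup ℚ_[p] (PadicAlgCl p)))
          (m : ↥(thetaEvaluation C hC hS hl hp2 hpl hζ mods f hf hmods h15 L hZ hcharY hlim Env I
            (LevelRetraction.ofAugmentation (EtaleThetaDataOfSetting.phi C) (D.lDeltaTheta l)
              (EtaleThetaDataOfSetting.aug C) I.Dmu hDq (EtaleThetaDataOfSetting.PiYdd C)
              (EtaleThetaDataOfSetting.continuous_aug C) (aug_ker_acts_trivially C) hlift hemb)
            cU (EtaleThetaDataOfSetting.isOpen_stabilizer_units C) (EtaleThetaDataOfSetting.finiteIndex_stabilizer_units C)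
            (unitGroup ℚ_[p] (PadicAlgCl p)) ρlim).MxTM)
          (w : (nonzeroIntegers D.toTemperedCurve.mlfClosurePadic.k D.toTemperedCurve.mlfClosurePadic.K)ˣ),
          (m : (thetaEvaluation C hC hS hl hp2 hpl hζ mods f hf hmods h15 L hZ hcharY hlim Env I
            (LevelRetraction.ofAugmentation (EtaleThetaDataOfSetting.phi C) (D.lDeltaTheta l)
              (EtaleThetaDataOfSetting.aug C) I.Dmu hDq (EtaleThetaDataOfSetting.PiYdd C)
              (EtaleThetaDataOfSetting.continuous_aug C) (aug_ker_acts_trivially C) hlift hemb)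
            cU (EtaleThetaDataOfSetting.isOpen_stabilizer_units C) (EtaleThetaDataOfSetting.finiteIndex_stabilizer_units C)
            (unitGroup ℚ_[p] (PadicAlgCl p)) ρlim).Hd) =
              Multiplicative.toAdd (h1LimKummer (EtaleThetaDataOfSetting.phi C) (D.lDeltaTheta l) I.Dmu cU
                (EtaleThetaDataOfSetting.isOpen_stabilizer_units C) (EtaleThetaDataOfSetting.finiteIndex_stabilizer_units C) u) →
          ((w : nonzeroIntegers D.toTemperedCurve.mlfClosurePadic.k D.toTemperedCurve.mlfClosurePadic.K) :
              D.toTemperedCurve.mlfClosurePadic.K) = ((u : (PadicAlgCl p)ˣ) : PadicAlgCl p) →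
            e (Multiplicative.ofAdd (QuotientAddGroup.mk m)) =
              (AbsTopMonoids.genuineOfModelIsm (setting C hC hS hl hp2 hpl hζ mods f hf) D.toTemperedCurve.mlfClosurePadic D.toTemperedCurve.galoisEpsilonPadic hΔ hq).actIsm G
                ((AbsTopMonoids.genuineOfModelIsm (setting C hC hS hl hp2 hpl hζ mods f hf) D.toTemperedCurve.mlfClosurePadic D.toTemperedCurve.galoisEpsilonPadic hΔ hq).toIsm G w')
                (QuotientGroup.mk (Units.map (AbsTopMonoids.Genuine.liftM D.toTemperedCurve.mlfClosurePadic
                  (AbsTopMonoids.Genuine.phiOf D.toTemperedCurve.mlfClosurePadic D.toTemperedCurve.galoisEpsilonPadic φ)).toMonoidHom w))} := by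
  letI : IsNonarchimedeanLocalField ℚ_[p] := Padic.isNonarchimedeanLocalField_holds p
  haveI : FiniteDimensional ℚ_[p] D.K := D.finiteDimensional_K
  -- all local-field / closure instances of `K` passed EXPLICITLY (the extended absolute value of the trunk)
  exact @cor112_iii_model_genuineZHat_of_tower p _ D E l C hC hS hl hp2 hpl hζ mods f hf hmods h15 L hZ hcharY hlim Env I hDq hlift
    hemb cU ρlim (↥D.K) _ (FiniteExtension.valuativeRel ℚ_[p] D.K) (FiniteExtension.topologicalSpace ℚ_[p] D.K)
    (FiniteExtension.isNonarchimedeanLocalField ℚ_[p] D.K)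
    (charZero_of_injective_algebraMap (algebraMap ℚ_[p] D.K).injective) _
    (Literature.FieldTheory.Galois.isAlgClosure_of_intermediateField D.K)
    D.toTemperedCurve.galoisEpsilonPadic hΔ hq _ D.finiteDimensional_K _ _ hcU G

end EtaleLevels

end Literature.IUT.HodgeArakelov

end
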